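import Literature.AnabelianGeometry.AbsoluteAnabelian.ArchimedeanReconstructionCor29Sub
import HarnessLib

/-!
# [AbsTopIII] Cor 2.9, successor statement of record `GlobalArchimedeanCompatibility'`: clause (b) AT
# PRINT STRENGTH — the topological FIELD isomorphism `𝒜_x ∪ {0} ⥲ k_v` pinned by the `ι_{U_X,x}`

S. Mochizuki, *Topics in absolute anabelian geometry III* [AbsTopIII] (bib key `MochizukiAbsTopIII2015`;
locators = kurims manuscript pages, lit key `paper:url-5493eb38cbb7`, read on the cell's render p0064–p0065),
Corollary 2.9 «Global-Archimedean Elliptically Admissible Compatibility», p.64 l.37 – p.65 l.34.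

Statements file (abc-iut cell, row «COR29b-RETYPE», abc-iut-L4-lead RULING #8a; seat abc-iut-L4-t4 gen 7).
The FROZEN statement of record `ArchimedeanReconstruction.GlobalArchimedeanCompatibility`
(`ArchimedeanReconstruction.lean`, p408225; UNTOUCHED) types clause (b) as `units_iso`: SOME family of
continuous multiplicative isomorphisms `𝒜_x ≃ₜ* k_vˣ` at the NF-points, compatible with the transitions
`𝒜_{x₁} ⥲ 𝒜_{x₂}`.  abc-iut-f-075's READING 2 (`ArchimedeanReconstructionCor29StatementReadings.lean`,
p437201: `GlobalArchimedeanCompatibility.units_iso_of_unitsEquiv`, `.of_clauses_a_of_unitsEquiv`) certified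
that clause WEAKER THAN PRINT: it follows from a bare `κu : ℂˣ ≃ₜ* k_vˣ` for every `L`, every NF-point
predicate and every datum (the interface `LocalLinearHolStructure` carries `isoUnits : ℂˣ ≃ₜ* 𝒜_p` with
`trans_isoUnits`), so the record says «`k_vˣ ≅ ℂˣ` as topological groups» — whereas print (p.65 l.14–22,
verbatim on the render) says: "(b) By letting the neighborhoods `U_X` of a fixed NF-point `x` vary, the
resulting `ι_{U_X,x}` determine an isomorphism of topological fields `𝒜_x ∪ {0} ⥲ k_v` via the condition of
compatibility [with respect to the `ι_{U_X,x}`] with the natural actions of `𝒜_x`, `k_v`, respectively, on the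
domain and codomain of `ι_{U_X,x}`.  Moreover, as `x` varies, these isomorphisms are compatible with the
isomorphisms `𝒜_{x₁} ∪ {0} ⥲ 𝒜_{x₂} ∪ {0}` [where `x₁, x₂ ∈ X(k_v)` are NF-points] of Corollary 2.7, (e)."
Class of the finding: typed-WEAK; repaired here by a SUCCESSOR declaration (the record stays for its consumers).

THE REPAIR.  Over the interface `LocalLinearHolStructure` the topological field structure of print on
`𝒜_x ∪ {0}` (Prop 2.6 (a) / Cor 2.7 (e)) is the one transported along the structure isomorphism
`isoUnits x : ℂˣ ⥲ 𝒜_x` (the interface's own docstring, `HolomorphicCores.lean`: "the field structure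
transported along `isoUnits` is the only one in play here").  Hence "an isomorphism of topological fields
`𝒜_x ∪ {0} ⥲ k_v`" is, read through `isoUnits x`, an isomorphism of topological fields `κ_x : ℂ ⥲ k_v` — a
ring isomorphism `ℂ ≃+* k_v` continuous in both directions (print p.63: `k_v` is "the completion of
`k̄ˣ_NF ∪ {0}` at `v`", an archimedean prime of `k̄_NF`, so `k_v ≅ ℂ`) —, its restriction to `𝒜_x` being
`Cor29.fieldIsoScalar L x κ_x = (isoUnits x)⁻¹ ≫ κ_xˣ : 𝒜_x ≃ₜ* k_vˣ`; and "determined by the `ι_{U_X,x}`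
via the condition of compatibility with the natural actions" is abc-iut-w5-d225's sub-DAG row b.r2
`Cor29.ScalarFieldIso L x act ladd ι e` (`ArchimedeanReconstructionCor29Sub.lean`, p414208: `ι(φ ·ₓ v⃗) =
e(φ) · ι(v⃗)` for `v⃗` near `x` — the pinning, a GERM condition, row b.r3 — and `e` additive for the
`+ₓ`-defined sums of germ automorphisms), REUSED BY NAME with `e := fieldIsoScalar L x κ_x`; the cross-point
sentence is row b.r4 `Cor29.ScalarCompatibleWithTrans`, by name, for THESE pinned isomorphisms.  As in the
sub-DAG file, the natural action `act x` of `𝒜_x` on points near `x` and the local addition `ladd x = (· +ₓ ·)`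
(Cor 2.7 (c)) are explicit parameters (the interface does not construct the germ groups), so the successor
has the parameter list of `NFCurveData.Cor29Refined`.  Clause (a) is carried at print strength too, by the
sub-DAG rows (by name): the neighbourhood `U_X` admitting the local additive structure (a.r1
`IsLocalAddDatumAt`), `ι_{U_X,x}` computing the limits through `df|_x` (a.r4 `IotaComputesLimits`, whence
a.r2/a.r3), a topological EMBEDDING (a.r5 `IotaIsEmbedding` — the record has only injectivity, with a
`TODO(general form)`), compatible with the local additive structures (a.r6 `IotaAdditive` — absent from the
record); the record's first clause `limit_depends_on_differential` is kept verbatim (it also governs the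
junk values of the total scaling datum off `U_X`).

* `Cor29.unitsOfFieldIso κ hκ hκ'` — the units part `ℂˣ ≃ₜ* k_vˣ` of a topological field isomorphism;
* `Cor29.fieldIsoScalar L x κ hκ hκ'` — `(isoUnits x)⁻¹ ≫ κˣ : 𝒜_x ≃ₜ* k_vˣ`, the restriction to `𝒜_x` of
  the field identification `𝒜_x ∪ {0} ≅ ℂ ⥲ k_v`;
* `Cor29.IotaPinsFieldIso L x act ladd ι κ` — clause (b) AT ONE NF-POINT, generic (any space `X`, any
  complete field `𝕜`): `κ` is bicontinuous and `fieldIsoScalar L x κ` satisfies row b.r2 for `ι`;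
* `GlobalArchimedeanCompatibility' D L isNFPoint cot d vanishesAt ladd scale fval act` — THE SUCCESSOR
  statement of record over the Cor 2.8 interface `NFCurveData`.

Proof-only companion (`ArchimedeanReconstructionCor29PrimeProofs.lean`): the successor IMPLIES the record;
the cross-point clause for pinned field isomorphisms is EQUIVALENT to `κ_{x₁} = κ_{x₂}` (one field
identification `ℂ ⥲ k_v` for all NF-points, by `trans_isoUnits`); and the successor holds for the genuine
datum under abc-iut-w4-d104's chart-package hypothesis (p436603), whose scalar isomorphisms ARE
`fieldIsoScalar` of the package's `κ`.
Honest scope (unchanged from the record and the sub-DAG): a `Prop`-valued schema over an interface the tree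
does not instantiate from `Π_X` (Thm 1.9 outputs, TODO-merge abc-iut-L4-t1); `isNFPoint`, `fval`, `act`, `ladd`
free parameters; functoriality (p.65 l.30–31) record-only; -- TODO(general form): the intrinsic topological
field structure on `𝒜_p ∪ {0}` of Prop 2.6 (a) is not a field of the interface (only its transport along
`isoUnits`).  Refereed pre-IUT material; nothing here bears on the disputed [IUTchIII] Cor. 3.12; typed ≠
proved.
-/

noncomputable section

namespace Literature.AnabelianGeometry.AbsoluteAnabelian

open _root_.Filter _root_.Topology

universe u v

namespace ArchimedeanReconstruction.Cor29

variable {X : Type u} [TopologicalSpace X] {𝕜 : Type v} [NontriviallyNormedField 𝕜]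

/-! ### An isomorphism of topological fields `ℂ ⥲ k_v` and its restriction to `𝒜_x` -/

/-- The units part `ℂˣ ⥲ k_vˣ` of an isomorphism of topological fields `κ : ℂ ⥲ k_v` (a ring isomorphism
continuous in both directions), as an isomorphism of topological groups.
[cite: MochizukiAbsTopIII2015, Corollary 2.9 (b) p.65] -/
def unitsOfFieldIso (κ : ℂ ≃+* 𝕜) (hκ : Continuous κ) (hκ' : Continuous κ.symm) : ℂˣ ≃ₜ* 𝕜ˣ :=
  { Units.mapEquiv κ.toMulEquiv with
    continuous_toFun := (Continuous.units_map (κ : ℂ →* 𝕜) hκ : Continuous (Units.map (κ : ℂ →* 𝕜)))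
    continuous_invFun :=
      (Continuous.units_map (κ.symm : 𝕜 →* ℂ) hκ' : Continuous (Units.map (κ.symm : 𝕜 →* ℂ))) }

/-- **The identification `𝒜_x ∪ {0} ⥲ k_v` restricted to `𝒜_x`**, for an isomorphism of topological fields
`κ : ℂ ⥲ k_v`: `(isoUnits x)⁻¹ ≫ κˣ : 𝒜_x ≃ₜ* k_vˣ` — the topological field structure on "`𝒜_x ∪ {0}`" being,
over the interface `LocalLinearHolStructure`, the one transported along the structure isomorphism
`isoUnits x : ℂˣ ⥲ 𝒜_x` of Prop 2.6 (a) / Cor 2.7 (e) (adjoin `0 ↦ 0`).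
[cite: MochizukiAbsTopIII2015, Corollary 2.9 (b) p.65] -/
def fieldIsoScalar (L : LocalLinearHolStructure X) (x : X) (κ : ℂ ≃+* 𝕜) (hκ : Continuous κ)
    (hκ' : Continuous κ.symm) : L.A x ≃ₜ* 𝕜ˣ :=
  (L.isoUnits x).symm.trans (unitsOfFieldIso κ hκ hκ')

/-! ### Clause (b) at one NF-point, generic -/

section Pinned

variable {C : Type*} [AddCommGroup C] [Module 𝕜 C]

/-- **Cor 2.9 (b) at one NF-point `x`, AT PRINT STRENGTH** (p.65 l.14–22): "the resulting `ι_{U_X,x}`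
determine an isomorphism of topological fields `𝒜_x ∪ {0} ⥲ k_v` via the condition of compatibility [with
respect to the `ι_{U_X,x}`] with the natural actions of `𝒜_x`, `k_v`, respectively, on the domain and codomain
of `ι_{U_X,x}`" — typed: `κ : ℂ ⥲ k_v` is an isomorphism of topological FIELDS (ring isomorphism, continuous
both ways) whose restriction `fieldIsoScalar L x κ : 𝒜_x ⥲ k_vˣ` (through `isoUnits x`) IS the scalar action of
`𝒜_x` read through `ι` near `x` and is additive for the `+ₓ`-defined sums of germ automorphisms — abc-iut-w5-d225's
row b.r2 `ScalarFieldIso`, by name.  `act` := the natural action of `𝒜_x` on points near `x`, `ladd := (· +ₓ ·)`.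
[cite: MochizukiAbsTopIII2015, Corollary 2.9 (b) p.65] -/
def IotaPinsFieldIso (L : LocalLinearHolStructure X) (x : X) (act : L.A x → X → X) (ladd : X → X → X)
    (ι : X → (C →ₗ[𝕜] 𝕜)) (κ : ℂ ≃+* 𝕜) : Prop :=
  ∃ (hκ : Continuous κ) (hκ' : Continuous κ.symm), ScalarFieldIso L x act ladd ι (fieldIsoScalar L x κ hκ hκ')

end Pinned

end ArchimedeanReconstruction.Cor29

/-! ### The successor statement of record over the Cor 2.8 interface `NFCurveData` -/

namespace ArchimedeanReconstruction

open Cor29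

variable (D : NFCurveData)

/-- **Cor 2.9 (a)/(b), SUCCESSOR STATEMENT OF RECORD** (row «COR29b-RETYPE»; the frozen
`GlobalArchimedeanCompatibility` p408225 stays), over the reconstructed space `X^top` of Cor 2.8 with a local
linear holomorphic structure `L` (Cor 2.7 (e)), the cotangent spaces `ω_x` with `f ↦ df|_x`, the local additive
structures `ladd x = (· +ₓ ·)` with division maps `scale x n = (1/n)·ₓ` (Cor 2.7 (c)), the values `fval`, and
the natural actions `act x` of the germ groups `𝒜_x` on points near `x`:
(a) for an NF-point `x` and `f` vanishing at `x`, "`(v⃗, f) ↦ lim_{n→∞} n · f((1/n) ·ₓ v⃗) ∈ k_v` … depends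
only on the image `df|_x ∈ ω_x`" (`limit_depends_on_differential`, verbatim the record's clause) and, for `v⃗`
in "a sufficiently small neighborhood `U_X ⊆ X^top` of `x` in `X^top` that admits such a local additive
structure" (row a.r1), "determines a topological embedding `ι_{U_X,x} : U_X ↪ Hom_{k_v}(ω_x, k_v)` that is
compatible with the 'local additive structures' of the domain and codomain" (rows a.r4, a.r5, a.r6);
(b) "the resulting `ι_{U_X,x}` determine an isomorphism of topological fields `𝒜_x ∪ {0} ⥲ k_v` via the
condition of compatibility [with respect to the `ι_{U_X,x}`] with the natural actions of `𝒜_x`, `k_v`" — a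
topological FIELD isomorphism `κ_x : ℂ ⥲ k_v` (through `isoUnits x`) whose restriction `fieldIsoScalar L x κ_x`
to `𝒜_x` is pinned to `ι_{U_X,x}` (row b.r2 `ScalarFieldIso`) — and "as `x` varies, these isomorphisms are
compatible with the isomorphisms `𝒜_{x₁} ∪ {0} ⥲ 𝒜_{x₂} ∪ {0}` … of Corollary 2.7, (e)" (row b.r4
`ScalarCompatibleWithTrans`, for THE pinned isomorphisms).  Functoriality (p.65 l.30–31) record-only, as in
the record.  -- TODO(general form): the intrinsic field structure of Prop 2.6 (a) on `𝒜_p ∪ {0}` (the interface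
records only its transport along `isoUnits`). [cite: MochizukiAbsTopIII2015, Corollary 2.9 pp.64–65] -/
structure GlobalArchimedeanCompatibility' (L : LocalLinearHolStructure D.Xtop)
    (isNFPoint : D.Xtop → Prop) (cot : D.Xtop → Type) [∀ x, AddCommGroup (cot x)]
    [∀ x, Module D.kv (cot x)] (d : ∀ x, D.Fn → cot x)
    (vanishesAt : D.Fn → D.Xtop → Prop)
    (ladd : D.Xtop → D.Xtop → D.Xtop → D.Xtop) (scale : D.Xtop → ℕ → D.Xtop → D.Xtop)
    (fval : D.Fn → D.Xtop → D.kv) (act : ∀ x, L.A x → D.Xtop → D.Xtop) : Prop where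
  /-- (a) the limit `lim n · f((1/n)·ₓ v⃗)` depends only on `df|_x` (verbatim the record's clause; quantified
  over all `v⃗`, so it also governs the junk values of the total datum `scale x` off `U_X`). -/
  limit_depends_on_differential : ∀ x, isNFPoint x → ∀ f g : D.Fn, vanishesAt f x →
    vanishesAt g x →
    d x f = d x g → ∀ v : D.Xtop, ∀ a : D.kv,
      Tendsto (fun n : ℕ => (n : D.kv) * fval f (scale x n v)) atTop (𝓝 a) →
      Tendsto (fun n : ℕ => (n : D.kv) * fval g (scale x n v)) atTop (𝓝 a)
  /-- (a) at every NF-point `x`: a neighbourhood `U_X` admitting the local additive structure at `x` (a.r1)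
  and the map `ι_{U_X,x} : U_X → Hom_{k_v}(ω_x, k_v)` computing the limits through `df|_x` (a.r4), a
  topological embedding (a.r5) compatible with the local additive structures (a.r6); (b) an isomorphism of
  topological fields `κ_x : ℂ ⥲ k_v`, i.e. `𝒜_x ∪ {0} ⥲ k_v` through `isoUnits x`, whose restriction to `𝒜_x`
  is pinned to `ι_{U_X,x}` by the compatibility with the natural actions (b.r2, a germ condition: b.r3), these
  pinned isomorphisms being compatible with the `𝒜_{x₁} ⥲ 𝒜_{x₂}` of Cor 2.7 (e) as `x` varies (b.r4). -/
  iota_fieldIso : ∃ (U : D.Xtop → Set D.Xtop) (ι : ∀ x, D.Xtop → (cot x →ₗ[D.kv] D.kv))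
      (κ : ∀ x, isNFPoint x → (ℂ ≃+* D.kv)) (hκ : ∀ x (hx : isNFPoint x), Continuous (κ x hx))
      (hκ' : ∀ x (hx : isNFPoint x), Continuous (κ x hx).symm),
    (∀ x (hx : isNFPoint x),
      IsLocalAddDatumAt (ladd x) (scale x) x (U x) ∧
        IotaComputesLimits fval (fun f => vanishesAt f x) (d x) (scale x) (U x) (ι x) ∧
        IotaIsEmbedding (U x) (ι x) ∧ IotaAdditive (ladd x) (scale x) (U x) (ι x) ∧
        ScalarFieldIso L x (act x) (ladd x) (ι x) (fieldIsoScalar L x (κ x hx) (hκ x hx) (hκ' x hx))) ∧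
    ∀ x₁ x₂ (h₁ : isNFPoint x₁) (h₂ : isNFPoint x₂),
      ScalarCompatibleWithTrans L x₁ x₂ (fieldIsoScalar L x₁ (κ x₁ h₁) (hκ x₁ h₁) (hκ' x₁ h₁))
        (fieldIsoScalar L x₂ (κ x₂ h₂) (hκ x₂ h₂) (hκ' x₂ h₂))

end ArchimedeanReconstruction

end Literature.AnabelianGeometry.AbsoluteAnabelian

end
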